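import Mathlib
import Summits.SmoothPoincare4.SmoothPoincare4.Theses.ConvexBisection
import Literature.Topology.FourManifolds.Gluing
import Literature.Topology.FourManifolds.ConnectedSum
import Literature.Topology.FourManifolds.ComplexProjectiveSpace
import Literature.Topology.FourManifolds.ClosedBall

/-!
# Sketch — crux-ideate stmt-SmoothPoincare4-3546 (ContractibleTwistedDoubleStandard), ideator 1, round 1

First lemmas of the two idea cards, stated (not proved) over existing declarations.

* `DoublesToSphere W` — "the double `D(W) = W ∪_id W̄` is diffeomorphic to `S⁴`" (relational:
  some double in the tree's sense `Literature.Topology.FourManifolds.IsDouble` is `≅ S⁴`).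
  True for Mazur-type `W` (Mazur 1961) and for every contractible 2-handlebody with stably
  Andrews–Curtis-trivial presentation (tree fact
  `Literature.Topology.FourManifolds.IsPresentationHandlebodyFive.nonempty_diffeomorph_closedBall_of_isStablyAndrewsCurtisEquivalent`,
  via `D(W) = ∂(W × I)`).
* `DissolutionLemma` (card `capped-swap-line-recognition`, first lemma): in the situation of the
  crux, if BOTH halves have standard doubles then every connected sum of `X` with `ℂℙ²`
  (the tree's `IsConnectedSum` is orientation-free, so this is `X # ℂℙ² ≅ ℂℙ²` AND
  `X # ℂℙ²bar ≅ ℂℙ²bar`) is diffeomorphic to `ℂℙ²`.  McDuff's `(+1)`-line recognition applied to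
  `W₂ ∪ (ℂℙ² ∖ W₁)`, `W₁` Gompf-isotoped to a Stein domain of `ℂ² ⊂ ℂℙ²`.
* `TransportLemma` (card `capped-swap-line-recognition`, rev 2 first lemma): Stein filling ∪
  Liouville cobordism-to-a-3-sphere `≅ B⁴` (Eliashberg–Gromov–McDuff transport), stated with
  explicit embeddings like the crux; replaces the dissolution lemma, whose proof sketch had a gap
  (a weakly concave cap does not accept arbitrary strong fillings — see the card's Dead lines).
* `MarkedReduction` (card `legendrian-r-knot-rigidity`, first lemma): in the situation of the
  crux, a diffeomorphism `Φ : W₁ → W₂` intertwining the two seam embeddings makes `X` a double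
  of `W₁`; with `DoublesToSphere W₁`, `X ≅ S⁴`.  (What the card's 3-dimensional lever delivers for
  Mazur-type halves via the Hayden–Mark–Piccirillo marking transfer.)
-/

open scoped Manifold ContDiff Topology
open Set Function

namespace Summit.SmoothPoincare4.SmoothPoincare4.Cruxes.ContractibleTwistedDoubleStandard.Ideator1

/-- Local notation: the round `S⁴ ⊂ ℝ⁵`. -/
local notation "𝕊⁴" => (Metric.sphere (0 : EuclideanSpace ℝ (Fin 5)) 1)

/-- `D(W) ≅ S⁴`: some (hence every, by uniqueness of gluing) double of the compact 4-manifold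
with boundary `W` is diffeomorphic to the round 4-sphere. -/
def DoublesToSphere (W : Type) [TopologicalSpace W] [ChartedSpace (EuclideanHalfSpace 4) W] : Prop :=
  ∃ (b : Literature.Topology.FourManifolds.BoundaryData (𝓡∂ 4) W (𝓡 3)) (D : Type)
    (_ : TopologicalSpace D) (_ : ChartedSpace (EuclideanSpace ℝ (Fin 4)) D),
    Literature.Topology.FourManifolds.IsDouble b (𝓡 4) D ∧ Nonempty (D ≃ₘ⟮𝓡 4, 𝓡 4⟯ 𝕊⁴)

/-- **DISSOLUTION (card `capped-swap-line-recognition`, rev-1 first lemma, now a MILESTONE of the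
line, not a provable-now lemma).**  Crux hypotheses verbatim, plus: both halves have standard
doubles.  Conclusion: every connected sum `P` of `X` with `ℂℙ²` (orientation-free, tree
`IsConnectedSum`) is diffeomorphic to `ℂℙ²` — i.e. `X # ℂℙ² ≅ ℂℙ²` and `X # ℂℙ²bar ≅ ℂℙ²bar`.
STATUS (rev 2, same session): the intended proof (McDuff's `(+1)`-line recognition on
`W₂ ∪ (ℂℙ² ∖ W₁)`, `W₁` Gompf-isotoped to a Stein domain of `ℂ²`) needs the cap `ℂℙ² ∖ W₁` to be
STRONGLY concave along the seam; Gompf's theorem gives only `J`-convexity (= weak concavity of the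
cap), and a weakly concave cap does not accept arbitrary strong fillings (inflation can only be
cut off on the filling side — Eliashberg 2004 Prop 4.1 is about fillings).  Strong concavity of
that cap is equivalent to the card's hypothesis LRH, under which `TransportLemma` already gives
`X ≅ S⁴`; so this statement is implied by LRH and otherwise OPEN. -/
def DissolutionLemma : Prop :=
  ∀ (X : Type) [TopologicalSpace X] [T2Space X] [SecondCountableTopology X] [CompactSpace X]
    [ChartedSpace (EuclideanSpace ℝ (Fin 4)) X] [IsManifold (𝓡 4) ∞ X]
    (W₁ : Type) [TopologicalSpace W₁] [ChartedSpace (EuclideanHalfSpace 4) W₁] [IsManifold (𝓡∂ 4) ∞ W₁]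
    [CompactSpace W₁] [ContractibleSpace W₁]
    (W₂ : Type) [TopologicalSpace W₂] [ChartedSpace (EuclideanHalfSpace 4) W₂] [IsManifold (𝓡∂ 4) ∞ W₂]
    [CompactSpace W₂] [ContractibleSpace W₂]
    (J₁ : Literature.Geometry.Symplectic.SteinStructure W₁) (J₂ : Literature.Geometry.Symplectic.SteinStructure W₂)
    (e₁ : W₁ → X) (e₂ : W₂ → X),
    Manifold.IsSmoothEmbedding (𝓡∂ 4) (𝓡 4) ∞ e₁ → Manifold.IsSmoothEmbedding (𝓡∂ 4) (𝓡 4) ∞ e₂ →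
    Set.range e₁ ∪ Set.range e₂ = Set.univ →
    Set.range e₁ ∩ Set.range e₂ = e₁ '' (𝓡∂ 4).boundary W₁ →
    Set.range e₁ ∩ Set.range e₂ = e₂ '' (𝓡∂ 4).boundary W₂ →
    (∀ w₁ w₂, e₁ w₁ = e₂ w₂ →
      Submodule.map (mfderiv (𝓡∂ 4) (𝓡 4) e₁ w₁).toLinearMap (Literature.Geometry.Symplectic.contactPlane J₁.J w₁) =
      Submodule.map (mfderiv (𝓡∂ 4) (𝓡 4) e₂ w₂).toLinearMap (Literature.Geometry.Symplectic.contactPlane J₂.J w₂)) →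
    DoublesToSphere W₁ → DoublesToSphere W₂ →
    ∀ (P : Type) [TopologicalSpace P] [T2Space P] [SecondCountableTopology P]
      [ChartedSpace (EuclideanSpace ℝ (Fin 4)) P] [IsManifold (𝓡 4) ∞ P],
      Literature.Topology.FourManifolds.IsConnectedSum (𝓡 4) (𝓡 4) (𝓡 4) X
        Literature.Topology.FourManifolds.ComplexProjectivePlane P →
      Nonempty (P ≃ₘ⟮𝓡 4, 𝓡 4⟯ Literature.Topology.FourManifolds.ComplexProjectivePlane)

/-- **First lemma of card `legendrian-r-knot-rigidity` (MARKED REDUCTION).**  Crux hypotheses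
verbatim, plus: a diffeomorphism `Φ : W₁ → W₂` intertwining the seam embeddings
(`e₂ (Φ w) = e₁ w` on `∂W₁`, i.e. `Φ|∂` IS the gluing contactomorphism) and `D(W₁) ≅ S⁴`.
Conclusion: `X ≅ S⁴`.  Pure gluing bookkeeping (`X` is then a double of `W₁`; uniqueness of
gluing, tree `Literature.Topology.FourManifolds.nonempty_diffeomorph_of_isBoundaryGluing`). -/
def MarkedReduction : Prop :=
  ∀ (X : Type) [TopologicalSpace X] [T2Space X] [SecondCountableTopology X] [CompactSpace X]
    [ChartedSpace (EuclideanSpace ℝ (Fin 4)) X] [IsManifold (𝓡 4) ∞ X]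
    (W₁ : Type) [TopologicalSpace W₁] [ChartedSpace (EuclideanHalfSpace 4) W₁] [IsManifold (𝓡∂ 4) ∞ W₁]
    [CompactSpace W₁] [ContractibleSpace W₁]
    (W₂ : Type) [TopologicalSpace W₂] [ChartedSpace (EuclideanHalfSpace 4) W₂] [IsManifold (𝓡∂ 4) ∞ W₂]
    [CompactSpace W₂] [ContractibleSpace W₂]
    (J₁ : Literature.Geometry.Symplectic.SteinStructure W₁) (J₂ : Literature.Geometry.Symplectic.SteinStructure W₂)
    (e₁ : W₁ → X) (e₂ : W₂ → X),
    Manifold.IsSmoothEmbedding (𝓡∂ 4) (𝓡 4) ∞ e₁ → Manifold.IsSmoothEmbedding (𝓡∂ 4) (𝓡 4) ∞ e₂ →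
    Set.range e₁ ∪ Set.range e₂ = Set.univ →
    Set.range e₁ ∩ Set.range e₂ = e₁ '' (𝓡∂ 4).boundary W₁ →
    Set.range e₁ ∩ Set.range e₂ = e₂ '' (𝓡∂ 4).boundary W₂ →
    (∀ w₁ w₂, e₁ w₁ = e₂ w₂ →
      Submodule.map (mfderiv (𝓡∂ 4) (𝓡 4) e₁ w₁).toLinearMap (Literature.Geometry.Symplectic.contactPlane J₁.J w₁) =
      Submodule.map (mfderiv (𝓡∂ 4) (𝓡 4) e₂ w₂).toLinearMap (Literature.Geometry.Symplectic.contactPlane J₂.J w₂)) →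
    (∃ Φ : W₁ ≃ₘ⟮𝓡∂ 4, 𝓡∂ 4⟯ W₂, ∀ w, w ∈ (𝓡∂ 4).boundary W₁ → e₂ (Φ w) = e₁ w) →
    DoublesToSphere W₁ →
    Nonempty (X ≃ₘ⟮𝓡 4, 𝓡 4⟯ 𝕊⁴)

/-- The 2-plane `ker (λ_p|T∂P) ⊂ T_p∂P` cut out on the boundary tangent hyperplane
`{v | v 0 = 0}` (chart convention of `Literature.Geometry.Symplectic.boundaryTangentSpace`) by a
`1`-form `λ` — the would-be contact plane of a contact-type boundary component. -/
noncomputable def kerPlane {P : Type} [TopologicalSpace P] [ChartedSpace (EuclideanHalfSpace 4) P]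
    (lam : Literature.Geometry.Kaehler.MForm (𝓡∂ 4) P ℝ 1) (p : P) :
    Submodule ℝ (EuclideanSpace ℝ (Fin 4)) :=
  Literature.Geometry.Symplectic.boundaryTangentSpace ⊓
    LinearMap.ker ((ContinuousAlternatingMap.ofSubsingleton ℝ (EuclideanSpace ℝ (Fin 4)) ℝ
      (0 : Fin 1)).symm (lam p)).toLinearMap

/-- **First lemma of card `capped-swap-line-recognition` (rev 2: TRANSPORT).**  A compact
4-manifold with boundary `G` which is the union of a compact contractible Stein domain
`(W₂, J₂)` and a compact piece `P` carrying a Liouville form `λ` (`dλ` non-degenerate; Liouville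
field pointing INTO `P` along the part of `∂P` glued to `∂W₂` — a concave end — and OUT of `P`
along the rest), glued so that the complex tangencies of `∂W₂` go to `ker (λ|T∂P)` (contact
matching), and whose free boundary is a 3-sphere, is diffeomorphic to the closed 4-ball.
Content: `W₂ ∪ P` is an exact (Liouville-glued) symplectic filling of a tight, hence standard,
`S³` (Eliashberg 1992), hence `≅ B⁴` (Gromov 1985 / Eliashberg 1990 Thm 5.1 / McDuff 1990 —
the exact-filling sibling of the tree fact
`Literature.Geometry.Symplectic.Eliashberg1990_steinFilling_sphere_three`).  With `P ≅ W̄₁ ∖ B⁴`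
rel `∂W₁` (the card's hypothesis LRH) this gives `X ∖ B⁴ ≅ B⁴`, i.e. `X ≅ S⁴` by Cerf. -/
def TransportLemma : Prop :=
  ∀ (G : Type) [TopologicalSpace G] [T2Space G] [SecondCountableTopology G] [CompactSpace G]
    [ChartedSpace (EuclideanHalfSpace 4) G] [IsManifold (𝓡∂ 4) ∞ G]
    (W₂ : Type) [TopologicalSpace W₂] [ChartedSpace (EuclideanHalfSpace 4) W₂] [IsManifold (𝓡∂ 4) ∞ W₂]
    [CompactSpace W₂] [ContractibleSpace W₂]
    (J₂ : Literature.Geometry.Symplectic.SteinStructure W₂)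
    (P : Type) [TopologicalSpace P] [ChartedSpace (EuclideanHalfSpace 4) P] [IsManifold (𝓡∂ 4) ∞ P]
    [CompactSpace P]
    (lam : Literature.Geometry.Kaehler.MForm (𝓡∂ 4) P ℝ 1)
    (eW : W₂ → G) (eP : P → G),
    Manifold.IsSmoothEmbedding (𝓡∂ 4) (𝓡∂ 4) ∞ eW → Manifold.IsSmoothEmbedding (𝓡∂ 4) (𝓡∂ 4) ∞ eP →
    Set.range eW ∪ Set.range eP = Set.univ →
    Set.range eW ∩ Set.range eP = eW '' (𝓡∂ 4).boundary W₂ →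
    Set.range eW ∩ Set.range eP ⊆ eP '' (𝓡∂ 4).boundary P →
    -- `λ` is a Liouville form: smooth, `dλ` non-degenerate …
    Literature.Geometry.Kaehler.IsSmoothForm lam →
    (∀ p (v : EuclideanSpace ℝ (Fin 4)),
      (∀ w : EuclideanSpace ℝ (Fin 4), Literature.Geometry.Kaehler.mextDeriv lam p ![v, w] = 0) → v = 0) →
    -- … whose Liouville field points INTO `P` along the glued (concave) part of `∂P` …
    (∀ p, (𝓡∂ 4).IsBoundaryPoint p → eP p ∈ Set.range eW →
      ∀ v : EuclideanSpace ℝ (Fin 4),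
        (∀ w : EuclideanSpace ℝ (Fin 4), Literature.Geometry.Kaehler.mextDeriv lam p ![v, w] = lam p ![w]) →
        0 < v 0) →
    -- … and OUT of `P` along the free (convex) part
    (∀ p, (𝓡∂ 4).IsBoundaryPoint p → eP p ∉ Set.range eW →
      ∀ v : EuclideanSpace ℝ (Fin 4),
        (∀ w : EuclideanSpace ℝ (Fin 4), Literature.Geometry.Kaehler.mextDeriv lam p ![v, w] = lam p ![w]) →
        v 0 < 0) →
    -- contact matching along the seam
    (∀ w p, eW w = eP p →
      Submodule.map (mfderiv (𝓡∂ 4) (𝓡∂ 4) eW w).toLinearMap (Literature.Geometry.Symplectic.contactPlane J₂.J w) =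
      Submodule.map (mfderiv (𝓡∂ 4) (𝓡∂ 4) eP p).toLinearMap (kerPlane lam p)) →
    -- the free boundary of `G` is a 3-sphere
    (∃ bG : Literature.Topology.FourManifolds.BoundaryData (𝓡∂ 4) G (𝓡 3),
      Nonempty (bG.carrier ≃ₘ⟮𝓡 3, 𝓡 3⟯ Metric.sphere (0 : EuclideanSpace ℝ (Fin 4)) 1)) →
    Nonempty (G ≃ₘ⟮𝓡∂ 4, 𝓡∂ 4⟯ Metric.closedBall (0 : EuclideanSpace ℝ (Fin 4)) 1)

/-- Sanity: the dissolution lemma and marked reduction both specialise the crux's data; the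
crux itself (for the record, by name). -/
example : Prop := Summit.SmoothPoincare4.SmoothPoincare4.Theses.ConvexBisection.ContractibleTwistedDoubleStandard

end Summit.SmoothPoincare4.SmoothPoincare4.Cruxes.ContractibleTwistedDoubleStandard.Ideator1
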